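import Summits.BirchSwinnertonDyer.Rank1Residual.PrintCfram.BottomClassIndexLawFiveLeLine
import Literature.NumberTheory.EllipticCurves.BSDSelmerPConverse
import Literature.NumberTheory.EllipticCurves.BSDQuotientOverNumberField
import HarnessLib

/-!
# Crux `PrintCFram.BottomClassIndexLawFiveLe` (item stmt-BirchSwinnertonDyer-20372) — line `katz-genus-crossing`
# (ideator seat bsd-idea-7, generation g2, lens «complete» = program-completion: Bertolini–Darmon–Prasanna 2012,
# «p-adic Rankin L-series and rational points on CM elliptic curves» — the Katz-vs-Heegner FACTORISATION that re-proves
# Rubin's formula at a SPLIT prime — completed at the prime RAMIFIED in the CM field through the GENUS FIELD)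

HONEST FRAMING. Nothing is proved about BSD here: three `sorry`'d stubs and one kernel-checked composition
`BottomClassIndexLawFiveLe_of : BottomClassIndexLawFiveLe` (proof = the three stubs by name + the tree's hypothesis-free
`Rank1Residual.PrintCfram.bottomClassIndexLawFiveLe_of_rubinFormulaZp`). BSD is not proved by any of this. The K7r item 19945
(`EllipticUnitValueSevenOfGZK`, the 𝒞₇@7 instance, cell `bsd-cm`) is CITED as the pattern and never duplicated; the g0 line of
this seat (`Lines/relative_anchor_transfer.lean`: unit anchor + Kohnen–Waldspurger relative transfer inside ONE class) and the
cell's vertical tower are different cuts — this line never compares two rank-one members and never uses half-integral weight.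

THE CRUX IN THE KERNEL. Class-wide at every ramified `p ≥ 5` (`K = ℚ(√−p)`, `p ∈ {7, 11, 19, 43, 67, 163}`, seven `j`-classes of
quadratic twists) the residual is the analytic ramified Rubin formula `S_open = X12.O11.RamifiedCMRubinFormulaAtZp W p`:
`λ₀(D) = 2(n + n') + ord_p #Ш_an(W) + ord_p #Ш_an(W')` for the bottom elliptic-unit class of [BKNO] (arXiv:2608.06879), whose
§1.4 defers exactly the rank-one VALUE formula at the ramified prime.

THE LEVER OF THIS LINE — ONE NEW OBJECT. Choose an auxiliary prime `ℓ ≡ 3 (mod 4)`, `ℓ ∤ N_W`, with `(−ℓ / p) = +1` and with the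
prime twist `W₁ = W^{(−ℓ)}` of analytic rank ZERO (stub 1). Put `K'' = ℚ(√−ℓ)` and let `F = K·K'' = ℚ(√−p, √−ℓ)` be the GENUS
(biquadratic CM) field. Because `p` splits in `K''`, the prime of `F⁺ = ℚ(√pℓ)` above `p` splits in `F/F⁺`, so `F` carries a
`p`-ORDINARY CM type `Σ` and KATZ's `p`-adic `L`-function `L_{p,Σ}(F)` EXISTS (Katz 1978; Hida–Tilouine 1993) — although `p` is
ramified in `K` (no Katz measure over `K`) and `f_W` is supercuspidal at `p` (no finite-slope refinement; barrier list (A)/(E)).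
By Mackey/Artin formalism for the two inductions `Ind_K^ℚ ψ_W` and `Ind_{K''}^ℚ λ`,
  `L(F, (ψ_W ∘ N_{F/K})·(λ ∘ N_{F/K''}), s) = L(f_W × θ_λ, s)`   for every Hecke character `λ` of `K''`,
so ONE measure on `F` restricts (i) along the `K''`-anticyclotomic line to the Bertolini–Darmon–Prasanna / Liu–Zhang–Zhang
family of `(f_W, K'')` — whose value at the crossing character is `log_ω(y_{K''})²` up to an explicit unit-controlled factor,
`y_{K''} ∈ W(ℚ)` the Heegner point (p-adic Waldspurger; `p` split in `K''`, CM points of `K''` ordinary), and (ii) along the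
`K`-directions to products of elliptic-unit values of `ψ_W` and of `ψ_{W₁} = ψ_W·χ_{−ℓ}` — [BKNO]'s `ℒ`'s, where the factor for the
RANK-ZERO twist `W₁` is a CLASSICAL explicit-reciprocity value `~ L(W₁,1)/Ω₁` (Coates–Wiles/Rubin shape, no deferred formula).
Equality of the two restrictions at the crossing point converts the deferred rank-one value `ℒ_W(𝟙)` into
`log_ω(y_{K''})² / (L(W₁,1)/Ω₁)` up to explicit factors; then the complex explicit Gross–Zagier formula over `K''`
(`L'(W,1)·L(W₁,1) ≐ ĥ(y_{K''})`, Cai–Shu–Tian 2014 / Yuan–Zhang–Zhang) and the REFEREED rank-zero `p`-part of BSD for the CM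
twist `W₁` at every prime (González-Avilés 1997, Burungale–Flach 2024 — barrier list (D), used here as a RESOURCE; stub 2) turn
it into `λ₀ = 2(n + n') + ord_p #Ш_an(W) + ord_p #Ш_an(W')` (the frame partner `W' ~ W^{(−p)}` is isogenous to `W`; its `Ш_an`
differs from `W`'s by an explicit isogeny factor). The research content is stub 3 (the crossing identity at ramified `p ∣ N`).

WHY EASIER THAN THE CRUX: the rank-one `p`-adic value formula at a supercuspidal prime (no tool in print) is replaced by
(a) `p`-adic interpolation on `GL₁/F` at a `p`-ORDINARY CM type (Katz's refereed theory), (b) a `p`-adic Waldspurger value on the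
ordinary CM locus of `K''` (BDP 2013 / LZZ 2018 technology; the only new point is tame level divisible by `p²`), (c) a rank-ZERO
elliptic-unit value (classical) and (d) rank-ZERO BSD_p (a theorem). Ш never comes from a Heegner-point Kolyvagin system, so the
reducibility of `W[p]` (barrier list (C), `ReducibleAnticyclotomicAtBadP`) is never met: Ш stays on the elliptic-unit side of
`S_open`'s own main-conjecture binder.

PRINTED INPUTS / SOURCES: [BKNO] arXiv:2608.06879 Thm. 1.5, 4.12, 7.2, §1.4; Bertolini–Darmon–Prasanna, Pacific J. Math. 260
(2012) 261–303 (Katz ↔ generalised-Heegner factorisation ⇒ Rubin's formula, split `p`, `p ∤ N`) and Duke Math. J. 162 (2013);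
Liu–Zhang–Zhang, Duke Math. J. 167 (2018) («A p-adic Waldspurger formula»); Katz, Invent. Math. 49 (1978); Hida–Tilouine,
Ann. Sci. ÉNS 26 (1993); Cai–Shu–Tian, Algebra Number Theory 8 (2014) (explicit Gross–Zagier); Ono, J. reine angew. Math. 533
(2001) / Ono–Skinner, Invent. Math. 134 (1998) (rank-zero prime twists in Frobenian sets); González-Avilés, Trans. AMS 349 (1997);
Burungale–Flach, Camb. J. Math. 12 (2024) Cor. 2 (tree fact `bsdTriple_of_hasCM_of_L_one_ne_zero`); Rubin, Invent. Math. 103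
(1991). Barrier: `Literature.Barriers.BirchSwinnertonDyer.CMRankOneAtRamifiedPrime` — lists (A)/(E) (finite slope / `p ∤ N` for
automorphic constructions) are evaded because the interpolation is on `GL₁/F` with an ordinary CM type; list (C) (Kolyvagin needs
`Irr`) is evaded because no Heegner Kolyvagin system is used; list (D) (rank zero holds at every prime) is the resource of stub 2.
RESHAPE (lead seat `bsd-line-cfram-p1`, g2, 2026-08-28; same slug, same composition idea «rank-zero twist in
whose imaginary quadratic field `p` SPLITS + refereed rank-zero `BSD_p` + crossing», four stubs instead of
three; kernel evidence `Theorems/PrintCFramBottomClassIndexLawFiveLeGenusCrossingAnatomy.lean` /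
`…GenusCrossingHeegnerField.lean`): (1) critic-10 #11 (P3) — the PRIME twist `−ℓ` with a residue condition
at `p` is not in print; it is replaced by the discriminant `d_K` of an imaginary quadratic `K` in which every
prime of `N_W` AND `p` split (Hoffstein–Luo 1997 / Friedberg–Hoffstein; PROVED in the tree modulo
`exists_isNewformOf` + `HoffsteinLuo1997_exists_twist_L_one_ne_zero`: `KatzGenusCrossing.exists_heegnerField_rankZeroTwist`);
the genus field `F = ℚ(√−p)·K` still has a `p`-ordinary CM type (only «`p` splits in `K`» is used), and `K`
now also carries classical Heegner points for `N_W`. (2) critic-10 #11 (P2)/(P5) — stub 3 is split into the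
ASSEMBLY `stub_heegnerFieldDescent` (Artin formalism + Milne's Weil restriction: `BSD(W/K,p) ∧ BSD(W₁,p) ⟹
BSD(W,p) ⟹ S_open`; PROVED modulo GZK (the crux's antecedent, threaded) + modularity + Cassels + Milne:
`KatzGenusCrossing.heegnerFieldDescent_of_facts`) and the RESEARCH stub `stub_heegnerFieldPPart` = Miller's
`BSD(W/K, p)` on `W.baseChange K` (`BSDpOver`), the statement the genus-field crossing identity / a
Heegner-point main conjecture over `K` would deliver. In the kernel, given stub 2, `stub_heegnerFieldPPart` at
a datum is EXACTLY `BSD(W,p)` (`KatzGenusCrossing.pPartOverHeegnerField_iff_bsdp`): crux-sized, honest, and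
outside every printed scope (barrier `CMRankOneAtRamifiedPrime` (A) `p ∤ N`, (C) `Irr`: here `W` is additive
at `p` with `W[p]` reducible). Stubs 1, 2, 3 are closed MODULO refereed named facts by the two Theorems
files; stub 4 carries the research. BSD is not proved by any of this.
-/

set_option linter.dupNamespace false

open WeierstrassCurve Literature.NumberTheory.EllipticCurves Literature.NumberTheory.EllipticCurves.Rank1Residual
  Summit.BirchSwinnertonDyer.Rank1Residual.X12.O11

namespace Summit.BirchSwinnertonDyer.BirchSwinnertonDyer.Cruxes.BottomClassIndexLawFiveLe.KatzGenusCrossing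

open Summit.BirchSwinnertonDyer.BirchSwinnertonDyer.Theses.PrintCFram

/-- **Stub 1 (RANK-ZERO TWIST BY A HEEGNER FIELD IN WHICH `p` SPLITS; in print, M as a formalisation).** For
every globally minimal CM curve `W/ℚ` of analytic rank one and every prime `p ≥ 5` ramified in its CM field
there are an imaginary quadratic field `K` in which every prime dividing the conductor `N_W` splits (Heegner
hypothesis) and `p` splits (so the genus field `ℚ(√−p)·K` has a `p`-ordinary CM type and `W/K` has Heegner
points of conductor `1`), and a globally minimal model `W₁` of the twist `W^{(d_K)}` — same `j`, hence CM and
CM-ramified at `p` — of analytic rank ZERO. In print: `w(W) = −1` (odd analytic rank, modularity) and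
Hoffstein–Luo 1997 with the primes of `N_W·p` adjoined to `S` (sign of the twist by Murty–Murty Ch. 6 §1);
PROVED modulo the named facts `exists_isNewformOf`, `HoffsteinLuo1997_exists_twist_L_one_ne_zero` as
`Theorems.PrintCFram.KatzGenusCrossing.exists_heegnerField_rankZeroTwist`. Why it might fail: only if those
two refereed facts fail. -/
theorem stub_rankZeroHeegnerTwist :
    ∀ (W : WeierstrassCurve ℚ) [W.IsElliptic] [W.IsGloballyMinimal] (p : ℕ) [Fact p.Prime],
      W.HasCM → CMRamified W p → 5 ≤ p → W.analyticRank = 1 →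
      ∃ (K : Type) (_ : Field K) (_ : NumberField K) (W₁ : WeierstrassCurve ℚ) (_ : W₁.IsElliptic)
        (_ : W₁.IsGloballyMinimal) (C₁ : VariableChange ℚ),
        IsImaginaryQuadratic K ∧ SatisfiesHeegnerHypothesis (W.conductorNorm ℤ) K ∧
        SatisfiesHeegnerHypothesis p K ∧ C₁ • W₁ = W.quadraticTwist (NumberField.discr K : ℚ) ∧
        W₁.j = W.j ∧ W₁.HasCM ∧ CMRamified W₁ p ∧ W₁.analyticRank = 0 := by
  sorry

/-- **Stub 2 (RANK-ZERO `p`-PART OF BSD FOR THE CM TWIST AT THE RAMIFIED PRIME; in print, L as a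
formalisation) — unchanged from the g2 ideator's skeleton.** For a globally minimal CM curve `W₁/ℚ` of
analytic rank ZERO and a prime `p ≥ 5` ramified in its CM field, `BSD(W₁, p)` holds. Rubin 1991 Thm. 11.1,
González-Avilés 1997, Burungale–Flach 2024 Cor. 2 (barrier list (D) as a resource); PROVED modulo the named
facts `bsdTriple_of_hasCM_of_L_one_ne_zero`, `hasEntireLFunction_rat` as
`Theorems.PrintCFram.KatzGenusCrossing.stub_rankZeroTwistBSDp_of_facts`. Why it might fail: only as a
formalisation debt (the two facts). -/
theorem stub_rankZeroTwistBSDp :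
    ∀ (W₁ : WeierstrassCurve ℚ) [W₁.IsElliptic] [W₁.IsGloballyMinimal] (p : ℕ) [Fact p.Prime],
      W₁.HasCM → CMRamified W₁ p → 5 ≤ p → W₁.analyticRank = 0 → BSDp W₁ p := by
  sorry

/-- **Stub 3 (DESCENT FROM THE HEEGNER FIELD; in print, M as a formalisation).** Under GZK (the crux's own
antecedent, threaded here), for a member `W` at `p`, an imaginary quadratic `K`, and a globally minimal model
`W₁` of `W^{(d_K)}` of analytic rank `0` with `BSD(W₁, p)`: Miller's `BSD(W/K, p)` on the base-changed model
(`BSDpOver (W.baseChange K) p`) implies the analytic ramified Rubin formula `S_open(W, p)`. Content: Artin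
formalism `L(W/K,s) = L(W,s)·L(W₁,s)`, Milne 1972 Thm. 1 (Weil restriction, Dokchitser–Dokchitser any-model
form) ⟹ `BSD(W,p)` (cell `b2b-bsdres`, `AdditivePotMult.bsdp_of_pPartOverC_baseChange`), then cell `bsd-cm`'s
`ramifiedCMRubinFormulaAtZp_of_bsdp`. PROVED modulo `hasEntireLFunction_rat`, `bsdRHS_eq_of_isIsogenous`,
`Milne1972.bsdQuotient_baseChange_quadratic_anyModel` as
`Theorems.PrintCFram.KatzGenusCrossing.heegnerFieldDescent_of_facts`. Why it might fail: only as a formalisation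
debt (the three facts). -/
theorem stub_heegnerFieldDescent :
    rank_eq_analyticRank_of_analyticRank_le_one →
    ∀ (W : WeierstrassCurve ℚ) [W.IsElliptic] [W.IsGloballyMinimal] (p : ℕ) [Fact p.Prime],
      W.HasCM → CMRamified W p → 5 ≤ p → W.analyticRank = 1 →
      ∀ (K : Type) [Field K] [NumberField K] (W₁ : WeierstrassCurve ℚ) [W₁.IsElliptic] [W₁.IsGloballyMinimal]
        (C₁ : VariableChange ℚ), IsImaginaryQuadratic K →
        C₁ • W₁ = W.quadraticTwist (NumberField.discr K : ℚ) → W₁.analyticRank = 0 → BSDp W₁ p →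
        BSDpOver (W.baseChange K) p → RamifiedCMRubinFormulaAtZp W p := by
  sorry

/-- **Stub 4 (THE `p`-PART OF BSD OVER THE HEEGNER FIELD; L/XL, THE RESEARCH CONTENT).** For a member `W`
at the ramified `p ≥ 5`, an imaginary quadratic `K` satisfying the Heegner hypothesis for `N_W` and for `p`
(stub 1), and the globally minimal `d_K`-twist `W₁` of analytic rank `0` with `BSD(W₁, p)` (stub 2):
Miller's `BSD(W/K, p)` — `Ш(W/K)[p^∞]` finite and `ord_p #Ш_an(W/K) = ord_p #Ш(W/K)[p^∞]` on the model
`W.baseChange K` (Dokchitser–Dokchitser's `C(E/K)`). Here `r_an(W/K) = 1 + 0`, `p` SPLITS in `K`, `W` is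
ADDITIVE (potentially supersingular) at `p` and `W[p]` is REDUCIBLE. Intended proof (the g2 ideator's lever,
restated over `K`): Katz's measure on the genus field `F = ℚ(√−p)·K` for its `p`-ORDINARY CM type; Artin
formalism `L(F, ψ_W∘N·λ∘N) = L(f_W × θ_λ)`; along the `K`-anticyclotomic line the `p`-adic Waldspurger /
BDP value `log_ω(y_K)²` at the Heegner point `y_K ∈ W(K)` (Liu–Zhang–Zhang 2018: `p` split in `K` is the
only local hypothesis — critic-10 #11 (P1) checked); a Heegner-point (Perrin-Riou / Howard / BDP) main
conjecture divisibility for `(f_W, K)` at `p` would turn it into `BSD(W/K,p)`. Why it might fail: every printed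
divisibility of that kind assumes `p ∤ N` (BDP 2013 Assumption 5.12, Castella–Hsieh 2018, Jetchev–Skinner–Wan
2017; Castella–Grossi–Lee–Skinner 2022 at Eisenstein primes: good ordinary) or an irreducible `W[p]`
(Kolyvagin-system bounds, Matar–Nekovář 2019 Thm. 6.7; barrier `CMRankOneAtRamifiedPrime` (A)/(C)); in the
kernel, given stub 2 this stub at a datum is exactly `BSD(W, p)` (`KatzGenusCrossing.pPartOverHeegnerField_iff_bsdp`). -/
theorem stub_heegnerFieldPPart :
    ∀ (W : WeierstrassCurve ℚ) [W.IsElliptic] [W.IsGloballyMinimal] (p : ℕ) [Fact p.Prime],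
      W.HasCM → CMRamified W p → 5 ≤ p → W.analyticRank = 1 →
      ∀ (K : Type) [Field K] [NumberField K] (W₁ : WeierstrassCurve ℚ) [W₁.IsElliptic] [W₁.IsGloballyMinimal]
        (C₁ : VariableChange ℚ), IsImaginaryQuadratic K → SatisfiesHeegnerHypothesis (W.conductorNorm ℤ) K →
        SatisfiesHeegnerHypothesis p K → C₁ • W₁ = W.quadraticTwist (NumberField.discr K : ℚ) →
        W₁.analyticRank = 0 → BSDp W₁ p → BSDpOver (W.baseChange K) p := by
  sorry

/-- **Composition (kernel-checked, no `sorry` of its own): the four stubs — by name — give the crux BY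
NAME.** Under the crux's antecedent GZK, for a member `W` at `p`: stub 1 gives the Heegner field `K` and the
rank-zero twist `W₁ ≅ W^{(d_K)}`, stub 2 gives `BSD(W₁, p)`, stub 4 gives `BSD(W/K, p)`, stub 3 descends to
`S_open(W, p)`, and cell `bsd-cm`'s hypothesis-free `ramifiedCMRubinFormulaAtZp_iff_indexLawAtZp_holds`
reads `S_open` as the route's `RamifiedCMBottomClassIndexLawAtZp W p`. -/
theorem BottomClassIndexLawFiveLe_of : BottomClassIndexLawFiveLe :=
  fun hGZK W _ _ p _ hCM hram h5 hr ↦ by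
    obtain ⟨K, _, _, W₁, _, _, C₁, hK, hHN, hHp, htw, _hj, hCM₁, hram₁, hr₁⟩ :=
      stub_rankZeroHeegnerTwist W p hCM hram h5 hr
    have hB₁ : BSDp W₁ p := stub_rankZeroTwistBSDp W₁ p hCM₁ hram₁ h5 hr₁
    exact Summit.BirchSwinnertonDyer.BirchSwinnertonDyer.Theorems.RamifiedSevenEllipticUnits.RubinFormulaZpIffValue.ramifiedCMRubinFormulaAtZp_iff_indexLawAtZp_holds.1
      (stub_heegnerFieldDescent hGZK W p hCM hram h5 hr K W₁ C₁ hK htw hr₁ hB₁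
        (stub_heegnerFieldPPart W p hCM hram h5 hr K W₁ C₁ hK hHN hHp htw hr₁ hB₁))

end Summit.BirchSwinnertonDyer.BirchSwinnertonDyer.Cruxes.BottomClassIndexLawFiveLe.KatzGenusCrossing
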